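import Summits.Ventures.Crystal3D.Theorems.StickyWulffConstantCoaxialWallLawCslTops
import Summits.Ventures.Crystal3D.Theorems.StickyWulffConstantCoaxialWallLawGrainLedgerRimLocal
import HarnessLib

/-!
# The climbing riser count of a CSL twin grain on its NON-COINCIDENCE balls

HONEST FRAMING. Part of the venture `Summits/Ventures/Crystal3D` (cell `crystal3d-full`), helper
`--supports` the crux `CoaxialWallLaw` (stmt-Ventures-19481, `route-Ventures-StickyWulffConstant`),
REGISTERED line `WallLedgerF` (planner cf-p1 gen 16), stub `stub_coaxialTwoSlabAdhesion`
(terrace/riser slot ledger, RIGID rung, CSL case).  Rung infrastructure only.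

CSL twin pair in normal form `Λ₁ = L·Λ₀ + c`, `Λ₂ = L·Λ₀⁻ + c` (`…CslLattice`), clamped sample `P`
of `Λ₁` in `[−2R₀, −R₀] × disc ρ` inside a configuration `X`, `3 ≤ R₀ ≤ ρ`.  The wall credit of
the CSL rung sits on the NON-COINCIDENCE balls of the grain (`x ∈ X ∩ Λ₁ ∖ Λ₂`), where absorption
holds at weight one.  This file counts it:

* `csl_nonCoinc_tops_ge` — per in-plane slot `w`: the non-coincidence run tops of `P` number
  `≥ ½(√2 |⟪L w, e₃⟫| πρ² − 10√2 πρ) − 24(R₀+2)(ρ−1)` (`csl_card_tops_le_two_mul_nonCoinc` +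
  `tops_ge_lineCount` + the rim count);
* `csl_upPair_credits_ge` — pushed to structured run tops of `X ∩ Λ₁ ∖ Λ₂` along the climbing
  member of `±w` (`card_runTops_le_structured`; in-plane shifts preserve non-coincidence);
* `csl_upInPlane_credits_ge` — summed over the three in-plane classes with the tilt inequality:
  `Σ_{x ∈ X ∩ Λ₁ ∖ Λ₂} #{w : w₂ = 0, x + L w ∉ X, climbing} ≥ ½(√6·√(1 − ⟪L e₃, e₃⟫²)·πρ² − 30√2πρ) − 72(R₀+2)(ρ−1)`.

WHAT THIS IS NOT: the CSL grain lemma / assembly, the stub; rung F-C1 not moved.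
-/

noncomputable section

namespace Summit.Ventures.Crystal3D.Theorems

open Summit.Ventures.Crystal3D Finset
open Literature.MathematicalPhysics.StatisticalMechanics (fccStacking barlowStacking triangularVec₁
  triangularVec₂)
open Literature.Barriers.AtomisticToContinuum (barlowAddSubgroupOfConst)
open scoped InnerProductSpace

open scoped Classical in
/-- **Non-coincidence run tops of one in-plane class in the clamped sample of a CSL twin grain.**
`#{p ∈ P : p ∉ Λ₂, p + L w ∉ P} ≥ ½ (√2 |⟪L w, e₃⟫| πρ² − 10√2 πρ) − 24 (R₀ + 2)(ρ − 1)`. -/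
theorem csl_nonCoinc_tops_ge
    (L : EuclideanSpace ℝ (Fin 3) ≃ₗᵢ[ℝ] EuclideanSpace ℝ (Fin 3)) (c : EuclideanSpace ℝ (Fin 3))
    (X P : Finset (EuclideanSpace ℝ (Fin 3))) (R₀ ρ : ℝ) (hR₀ : 3 ≤ R₀) (hρ : R₀ ≤ ρ)
    (hX : ∀ p ∈ X, ∀ q ∈ X, p ≠ q → 1 ≤ dist p q) (hPX : P ⊆ X)
    (hP : ∀ p, p ∈ P ↔ (p ∈ (fun q => L q + c) '' fccStacking 1 (Real.sqrt (2 / 3)) ∧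
      -(2 * R₀) ≤ p 2 ∧ p 2 ≤ -R₀ ∧ p 0 ^ 2 + p 1 ^ 2 ≤ ρ ^ 2))
    {w : EuclideanSpace ℝ (Fin 3)} (hw : w ∈ fccSlots) (hw0 : w 2 = 0) :
    1 / 2 * (Real.sqrt 2 * |⟪L w, EuclideanSpace.single (2 : Fin 3) (1 : ℝ)⟫_ℝ| * Real.pi * ρ ^ 2 -
        10 * Real.sqrt 2 * Real.pi * ρ) - 24 * (R₀ + 2) * (ρ - 1) ≤
      ((P.filter fun p => p ∉ (fun q => L q + c) '' barlowStacking 1 (Real.sqrt (2 / 3))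
          (fun _ : ℤ => (-1 : ℤ)) ∧ p + L w ∉ P).card : ℝ) := by
  classical
  have hP' : ∀ p, p ∈ P ↔ (p ∈ (fun q => L q + c) '' fccStacking 1 (Real.sqrt (2 / 3)) ∧
      -(2 * R₀) ≤ p 2 ∧ p 2 ≤ -(2 * R₀) + R₀ ∧ p 0 ^ 2 + p 1 ^ 2 ≤ ρ ^ 2) := by
    intro p; rw [hP p, show -(2 * R₀) + R₀ = -R₀ by ring]
  obtain ⟨Ea, Eb, hEa, hEb, hdet, hframe, -⟩ := exists_frame_of_mem_fccSlots hw
  have h1 := tops_ge_lineCount L c (-(2 * R₀)) R₀ ρ (by linarith) hρ P hP' Ea Eb w hEa hEb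
    (norm_eq_one_of_mem_fccSlots hw) hdet hframe
  have h2 := csl_card_tops_le_two_mul_nonCoinc L c P R₀ ρ hR₀ hρ hP hw hw0
  have h2' : ((P.filter fun p => p + L w ∉ P).card : ℝ) ≤
      2 * ((P.filter fun p => p ∉ (fun q => L q + c) '' barlowStacking 1 (Real.sqrt (2 / 3))
          (fun _ : ℤ => (-1 : ℤ)) ∧ p + L w ∉ P).card : ℝ) +
        ((P.filter fun p => (ρ - 2) ^ 2 < p 0 ^ 2 + p 1 ^ 2).card : ℝ) := by exact_mod_cast h2
  have hPsep : ∀ p ∈ P, ∀ q ∈ P, p ≠ q → 1 ≤ dist p q :=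
    fun p hp q hq hpq => hX p (hPX hp) q (hPX hq) hpq
  have hPcell : ∀ p ∈ P, -(2 * R₀) ≤ p 2 ∧ p 2 ≤ -R₀ ∧ p 0 ^ 2 + p 1 ^ 2 ≤ ρ ^ 2 :=
    fun p hp => ((hP p).1 hp).2
  have hrim := card_cellRim_le P hPsep (-(2 * R₀)) (-R₀) ρ (by linarith) (by linarith) hPcell
  have e : -R₀ - -(2 * R₀) + 2 = R₀ + 2 := by ring
  rw [e] at hrim
  linarith

open scoped Classical in
/-- **Climbing vacancies of one in-plane pair `±L w` on the non-coincidence balls.** -/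
theorem csl_upPair_credits_ge
    (L : EuclideanSpace ℝ (Fin 3) ≃ₗᵢ[ℝ] EuclideanSpace ℝ (Fin 3)) (c : EuclideanSpace ℝ (Fin 3))
    (X P : Finset (EuclideanSpace ℝ (Fin 3))) (R₀ ρ : ℝ) (hR₀ : 3 ≤ R₀) (hρ : R₀ ≤ ρ)
    (hX : ∀ p ∈ X, ∀ q ∈ X, p ≠ q → 1 ≤ dist p q) (hPX : P ⊆ X)
    (hP : ∀ p, p ∈ P ↔ (p ∈ (fun q => L q + c) '' fccStacking 1 (Real.sqrt (2 / 3)) ∧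
      -(2 * R₀) ≤ p 2 ∧ p 2 ≤ -R₀ ∧ p 0 ^ 2 + p 1 ^ 2 ≤ ρ ^ 2))
    {w : EuclideanSpace ℝ (Fin 3)} (hw : w ∈ fccSlots) (hw0 : w 2 = 0) :
    1 / 2 * (Real.sqrt 2 * |⟪L w, EuclideanSpace.single (2 : Fin 3) (1 : ℝ)⟫_ℝ| * Real.pi * ρ ^ 2 -
        10 * Real.sqrt 2 * Real.pi * ρ) - 24 * (R₀ + 2) * (ρ - 1) ≤
      (((X.filter fun x => x ∈ (fun q => L q + c) '' fccStacking 1 (Real.sqrt (2 / 3)) ∧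
          x ∉ (fun q => L q + c) '' barlowStacking 1 (Real.sqrt (2 / 3)) (fun _ : ℤ => (-1 : ℤ))).filter
          fun x => x + L w ∉ X ∧ x 2 < (x + L w) 2).card : ℝ) +
      (((X.filter fun x => x ∈ (fun q => L q + c) '' fccStacking 1 (Real.sqrt (2 / 3)) ∧
          x ∉ (fun q => L q + c) '' barlowStacking 1 (Real.sqrt (2 / 3)) (fun _ : ℤ => (-1 : ℤ))).filter
          fun x => x - L w ∉ X ∧ x 2 < (x - L w) 2).card : ℝ) := by
  classical
  set e₃ : EuclideanSpace ℝ (Fin 3) := EuclideanSpace.single (2 : Fin 3) (1 : ℝ) with he₃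
  set Λ₁ : Set (EuclideanSpace ℝ (Fin 3)) := (fun q => L q + c) '' fccStacking 1 (Real.sqrt (2 / 3)) with hΛ₁
  set Λ₂ : Set (EuclideanSpace ℝ (Fin 3)) :=
    (fun q => L q + c) '' barlowStacking 1 (Real.sqrt (2 / 3)) (fun _ : ℤ => (-1 : ℤ)) with hΛ₂
  set NC : Finset (EuclideanSpace ℝ (Fin 3)) := X.filter (fun x => x ∈ Λ₁ ∧ x ∉ Λ₂) with hNC
  set G := barlowAddSubgroupOfConst 1 (Real.sqrt (2 / 3)) (fun _ : ℤ => (-1 : ℤ)) (fun _ => rfl) with hG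
  have hGmem : ∀ q, q ∈ G ↔ q ∈ barlowStacking 1 (Real.sqrt (2 / 3)) (fun _ : ℤ => (-1 : ℤ)) :=
    fun q => Iff.rfl
  have hρ0 : (0 : ℝ) ≤ ρ := by linarith
  -- in-plane shifts preserve non-coincidence
  have hshift : ∀ {u : EuclideanSpace ℝ (Fin 3)}, u ∈ fccSlots → u 2 = 0 → ∀ q, q ∈ Λ₁ → q ∉ Λ₂ →
      q + L u ∈ Λ₁ ∧ q + L u ∉ Λ₂ := by
    intro u hu hu0 q hq hq2
    refine ⟨movedFcc_add_site_mem L c hq (mem_fcc_of_mem_fccSlots hu), fun hmem => hq2 ?_⟩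
    have e : q = (q + L u) + L (-u) := by rw [map_neg]; abel
    rw [e]
    exact (add_map_mem_movedTwin_iff L c hmem).2
      ((hGmem _).1 (G.neg_mem ((hGmem _).2 (inPlane_slot_mem_twin hu hu0))))
  -- structured tops of a climbing in-plane slot `u` are climbing `u`-vacancies on `NC`
  have key : ∀ u ∈ fccSlots, u 2 = 0 → 0 < ⟪L u, e₃⟫_ℝ →
      1 / 2 * (Real.sqrt 2 * |⟪L u, e₃⟫_ℝ| * Real.pi * ρ ^ 2 - 10 * Real.sqrt 2 * Real.pi * ρ) -
          24 * (R₀ + 2) * (ρ - 1) ≤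
        ((NC.filter fun x => x + L u ∉ X ∧ x 2 < (x + L u) 2).card : ℝ) := by
    intro u hu hu0 hα
    have h1 := csl_nonCoinc_tops_ge L c X P R₀ ρ hR₀ hρ hX hPX hP hu hu0
    set P' : Finset (EuclideanSpace ℝ (Fin 3)) := P.filter (fun p => p ∉ Λ₂) with hP'
    have hP'NC : P' ⊆ NC := by
      intro p hp
      rw [hP', mem_filter] at hp
      rw [hNC, mem_filter]
      exact ⟨hPX hp.1, ((hP p).1 hp.1).1, hp.2⟩
    have hLu0 : L u ≠ 0 := by
      intro h0
      have : ‖L u‖ = 0 := by rw [h0, norm_zero]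
      rw [LinearIsometryEquiv.norm_map, norm_eq_one_of_mem_fccSlots hu] at this
      norm_num at this
    have hconvP := runConvex_clampedSample L c (-(2 * R₀)) (-R₀) ρ hρ0 P hP (mem_fcc_of_mem_fccSlots hu)
    have hconv : ∀ p ∈ P', ∀ d : ℕ, p + ((d : ℕ) : ℝ) • L u ∈ P' →
        ∀ k : ℕ, k ≤ d → p + ((k : ℕ) : ℝ) • L u ∈ P' := by
      intro p hp d hd k hk
      rw [hP', mem_filter] at hp hd ⊢
      refine ⟨hconvP p hp.1 d hd.1 k hk, ?_⟩
      -- `k` in-plane shifts keep `p` off `Λ₂`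
      have : ∀ n : ℕ, p + ((n : ℕ) : ℝ) • L u ∈ Λ₁ ∧ p + ((n : ℕ) : ℝ) • L u ∉ Λ₂ := by
        intro n
        induction n with
        | zero => simpa using And.intro ((hP p).1 hp.1).1 hp.2
        | succ n ih =>
          have h := hshift hu hu0 _ ih.1 ih.2
          have e : p + ((n + 1 : ℕ) : ℝ) • L u = p + ((n : ℕ) : ℝ) • L u + L u := by
            push_cast; rw [add_smul, one_smul, add_assoc]
          rw [e]; exact h
      exact (this k).2
    have h2 : (P.filter fun p => p ∉ Λ₂ ∧ p + L u ∉ P).card ≤ (P'.filter fun p => p + L u ∉ P').card := by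
      refine card_le_card fun p hp => ?_
      rw [mem_filter] at hp
      rw [mem_filter, hP', mem_filter, mem_filter]
      exact ⟨⟨hp.1, hp.2.1⟩, fun h => hp.2.2 h.1⟩
    have h3 : (P'.filter fun p => p + L u ∉ P').card ≤
        (NC.filter fun q => q + L u ∉ NC ∧ (q ∈ P' ∨ q - L u ∈ NC)).card := by
      convert card_runTops_le_structured NC P' (L u) hLu0 hP'NC hconv using 3
    have h4 : (NC.filter fun q => q + L u ∉ NC ∧ (q ∈ P' ∨ q - L u ∈ NC)).card ≤
        (NC.filter fun x => x + L u ∉ X ∧ x 2 < (x + L u) 2).card := by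
      refine card_le_card fun q hq => ?_
      rw [mem_filter] at hq ⊢
      obtain ⟨hqNC, hnot, -⟩ := hq
      have hq' := hqNC
      rw [hNC, mem_filter] at hq'
      obtain ⟨-, hqΛ₁, hqΛ₂⟩ := hq'
      refine ⟨hqNC, fun hmem => hnot ?_, ?_⟩
      · rw [hNC, mem_filter]
        exact ⟨hmem, hshift hu hu0 q hqΛ₁ hqΛ₂⟩
      · rw [apply_two_add_eq_inner]; linarith
    have hchain_nat : (P.filter fun p => p ∉ Λ₂ ∧ p + L u ∉ P).card ≤
        (NC.filter fun x => x + L u ∉ X ∧ x 2 < (x + L u) 2).card := h2.trans (h3.trans h4)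
    have hchain : ((P.filter fun p => p ∉ Λ₂ ∧ p + L u ∉ P).card : ℝ) ≤
        ((NC.filter fun x => x + L u ∉ X ∧ x 2 < (x + L u) 2).card : ℝ) := by
      exact_mod_cast hchain_nat
    exact h1.trans hchain
  -- the pair `±w`
  have hc1 : (0 : ℝ) ≤ ((NC.filter fun x => x + L w ∉ X ∧ x 2 < (x + L w) 2).card : ℝ) :=
    Nat.cast_nonneg _
  have hc2 : (0 : ℝ) ≤ ((NC.filter fun x => x - L w ∉ X ∧ x 2 < (x - L w) 2).card : ℝ) :=
    Nat.cast_nonneg _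
  have hrimnn : (0 : ℝ) ≤ 24 * (R₀ + 2) * (ρ - 1) := by
    have : (0 : ℝ) ≤ ρ - 1 := by linarith
    have : (0 : ℝ) ≤ R₀ + 2 := by linarith
    positivity
  rcases lt_trichotomy 0 ⟪L w, e₃⟫_ℝ with hpos | hzero | hneg
  · have := key w hw hw0 hpos
    rw [abs_of_pos hpos] at this ⊢
    linarith
  · rw [← hzero, abs_zero, mul_zero, zero_mul, zero_mul, zero_sub]
    have : 0 ≤ 10 * Real.sqrt 2 * Real.pi * ρ := by positivity
    linarith
  · have hw' : -w ∈ fccSlots := neg_mem_fccSlots hw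
    have hw0' : (-w) 2 = 0 := by rw [PiLp.neg_apply, hw0, neg_zero]
    have hpos' : 0 < ⟪L (-w), e₃⟫_ℝ := by rw [map_neg, inner_neg_left]; linarith
    have := key (-w) hw' hw0' hpos'
    have hin : ⟪L (-w), e₃⟫_ℝ = -⟪L w, e₃⟫_ℝ := by rw [map_neg, inner_neg_left]
    rw [hin] at this
    have e : (NC.filter fun x => x + L (-w) ∉ X ∧ x 2 < (x + L (-w)) 2) =
        (NC.filter fun x => x - L w ∉ X ∧ x 2 < (x - L w) 2) := by
      simp only [map_neg, ← sub_eq_add_neg]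
    rw [e, abs_neg, abs_of_neg hneg] at this
    rw [abs_of_neg hneg]
    linarith

open scoped Classical in
/-- **The climbing riser count of a CSL twin grain on its non-coincidence balls.**  See the module
docstring. -/
theorem csl_upInPlane_credits_ge
    (L : EuclideanSpace ℝ (Fin 3) ≃ₗᵢ[ℝ] EuclideanSpace ℝ (Fin 3)) (c : EuclideanSpace ℝ (Fin 3))
    (X P : Finset (EuclideanSpace ℝ (Fin 3))) (R₀ ρ : ℝ) (hR₀ : 3 ≤ R₀) (hρ : R₀ ≤ ρ)
    (hX : ∀ p ∈ X, ∀ q ∈ X, p ≠ q → 1 ≤ dist p q) (hPX : P ⊆ X)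
    (hP : ∀ p, p ∈ P ↔ (p ∈ (fun q => L q + c) '' fccStacking 1 (Real.sqrt (2 / 3)) ∧
      -(2 * R₀) ≤ p 2 ∧ p 2 ≤ -R₀ ∧ p 0 ^ 2 + p 1 ^ 2 ≤ ρ ^ 2)) :
    1 / 2 * (Real.sqrt 6 * Real.sqrt (1 - ⟪L (EuclideanSpace.single (2 : Fin 3) (1 : ℝ)),
        EuclideanSpace.single (2 : Fin 3) (1 : ℝ)⟫_ℝ ^ 2) * Real.pi * ρ ^ 2 -
        30 * Real.sqrt 2 * Real.pi * ρ) - 72 * (R₀ + 2) * (ρ - 1) ≤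
      ∑ x ∈ X.filter (fun x => x ∈ (fun q => L q + c) '' fccStacking 1 (Real.sqrt (2 / 3)) ∧
          x ∉ (fun q => L q + c) '' barlowStacking 1 (Real.sqrt (2 / 3)) (fun _ : ℤ => (-1 : ℤ))),
        (((fccSlots.filter fun w => w 2 = 0 ∧ (x + L w ∉ X ∧ x 2 < (x + L w) 2)).card : ℕ) : ℝ) := by
  classical
  obtain ⟨hus, hvs, huvs⟩ := inPlane_mem_fccSlots
  have hu0 : (triangularVec₁ (1 : ℝ)) 2 = 0 := triangularVec₁_one_apply.2.2
  have hv0 : (triangularVec₂ (1 : ℝ)) 2 = 0 := triangularVec₂_one_apply.2.2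
  have huv0 : (triangularVec₂ (1 : ℝ) - triangularVec₁ 1) 2 = 0 := by
    rw [PiLp.sub_apply, hu0, hv0, sub_zero]
  have cu := csl_upPair_credits_ge L c X P R₀ ρ hR₀ hρ hX hPX hP hus hu0
  have cv := csl_upPair_credits_ge L c X P R₀ ρ hR₀ hρ hX hPX hP hvs hv0
  have cuv := csl_upPair_credits_ge L c X P R₀ ρ hR₀ hρ hX hPX hP huvs huv0
  set NC := X.filter (fun x => x ∈ (fun q => L q + c) '' fccStacking 1 (Real.sqrt (2 / 3)) ∧
    x ∉ (fun q => L q + c) '' barlowStacking 1 (Real.sqrt (2 / 3)) (fun _ : ℤ => (-1 : ℤ))) with hNC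
  have hsum : ∑ x ∈ NC, (((fccSlots.filter fun w => w 2 = 0 ∧ (x + L w ∉ X ∧ x 2 < (x + L w) 2)).card : ℕ) : ℝ) =
      ((NC.filter fun p => p + L (triangularVec₁ 1) ∉ X ∧ p 2 < (p + L (triangularVec₁ 1)) 2).card : ℝ) +
      ((NC.filter fun p => p - L (triangularVec₁ 1) ∉ X ∧ p 2 < (p - L (triangularVec₁ 1)) 2).card : ℝ) +
      ((NC.filter fun p => p + L (triangularVec₂ 1) ∉ X ∧ p 2 < (p + L (triangularVec₂ 1)) 2).card : ℝ) +
      ((NC.filter fun p => p - L (triangularVec₂ 1) ∉ X ∧ p 2 < (p - L (triangularVec₂ 1)) 2).card : ℝ) +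
      ((NC.filter fun p => p + L (triangularVec₂ 1 - triangularVec₁ 1) ∉ X ∧
          p 2 < (p + L (triangularVec₂ 1 - triangularVec₁ 1)) 2).card : ℝ) +
      ((NC.filter fun p => p - L (triangularVec₂ 1 - triangularVec₁ 1) ∉ X ∧
          p 2 < (p - L (triangularVec₂ 1 - triangularVec₁ 1)) 2).card : ℝ) := by
    have h1 : ∑ x ∈ NC, ((fccSlots.filter fun w => w 2 = 0 ∧ (x + L w ∉ X ∧ x 2 < (x + L w) 2)).card : ℕ) =
        (NC.filter fun p => p + L (triangularVec₁ 1) ∉ X ∧ p 2 < (p + L (triangularVec₁ 1)) 2).card +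
        (NC.filter fun p => p - L (triangularVec₁ 1) ∉ X ∧ p 2 < (p - L (triangularVec₁ 1)) 2).card +
        (NC.filter fun p => p + L (triangularVec₂ 1) ∉ X ∧ p 2 < (p + L (triangularVec₂ 1)) 2).card +
        (NC.filter fun p => p - L (triangularVec₂ 1) ∉ X ∧ p 2 < (p - L (triangularVec₂ 1)) 2).card +
        (NC.filter fun p => p + L (triangularVec₂ 1 - triangularVec₁ 1) ∉ X ∧
            p 2 < (p + L (triangularVec₂ 1 - triangularVec₁ 1)) 2).card +
        (NC.filter fun p => p - L (triangularVec₂ 1 - triangularVec₁ 1) ∉ X ∧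
            p 2 < (p - L (triangularVec₂ 1 - triangularVec₁ 1)) 2).card := by
      rw [Finset.sum_congr rfl (fun x _ => card_upInPlane_eq_six L X x)]
      simp only [sum_add_distrib, ← card_filter]
    exact_mod_cast congrArg (Nat.cast : ℕ → ℝ) h1
  rw [hsum]
  have htilt := coaxial_sine_le_inPlaneClasses L
  have hπρ : 0 ≤ Real.pi * ρ ^ 2 := by positivity
  have hmul := mul_le_mul_of_nonneg_right htilt hπρ
  nlinarith [cu, cv, cuv, hmul]

end Summit.Ventures.Crystal3D.Theorems

end
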